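/-
Copyright (c) 2026 the pub-hodgecm-mathlib formalisation cell (harness21).  Prover seat hodgecm-mathlib-K2E3-p11 (g4),
Track B «K2-LIT» ∕ h413 (`stmt-HodgeConjecture-24833`), line `K2_E3_EllipticInputs`, unit U12, row #11 `sig_K2E3CharLocIntNearSemisimple`,
ROAD «11-3-split BY CLASS» brick K1 «MAXIMAL PARABOLIC DESCENT» — the unipotent change of variables for a maximal parabolic
`P = L ⋉ N` of `GL(m ⊕ n)`, Lie-algebra and group form.  2026-09-04.
-/
import Literature.MeasureTheory.Group.LocalFieldLinearJacobian   -- ★ (LH10-p01 g6) «LINEAR JACOBIAN OVER A LOCAL FIELD»: `map_continuousLinearEquiv_addHaar_of_trivialization`, `exists_continuousLinearEquiv_of_basis`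
import Mathlib.Data.Matrix.Block
import Mathlib.LinearAlgebra.Matrix.NonsingularInverse
import Mathlib.Topology.Instances.Matrix
import Mathlib.MeasureTheory.Integral.Bochner.Basic
import Mathlib.MeasureTheory.Measure.Haar.Unique
import HarnessLib

/-!
# K2_E3 road (h413), U12 row #11 — ROAD «11-3-split BY CLASS», brick K1: MAXIMAL PARABOLIC DESCENT on `GL(m ⊕ n)`

Cell `pub/hodgecm-mathlib` (D-0151), Track B (21-frontier RULING «PUSH BOTH» 2026-09-03, director req624), seat K2E3-p11 (g4); dealer K2E3-plan (g3);
announced on the squad bus 2026-09-04T03:40Z.  `--supports stmt-HodgeConjecture-24833 --as helper`; THEOREMS ONLY (no definition ∕ instance ∕ notation ∕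
named fact ∕ `sorry`); never imports `Cruxes/…/Lines`.  COUNT-NEUTRAL: row #11 (`sig_K2E3CharLocIntNearSemisimple`, U12 :216) and its leaf (11-3-split) stay OPEN;
this file is the first analytic brick of the by-class road for `U_3(H)(L⁺_v) ≃ GL₃(L_w)` at a SPLIT place `v` (★ `charLocIntNearSemisimple_of_split`), written in
the generality of a MAXIMAL PARABOLIC of `GL(m ⊕ n)` over any locally compact second countable field `F` (so it also serves the Richardson form of (L-B_GL),
van Dijk's induced-character formula for `P_{a,b} ⊂ GL_{a+b}` and Harish-Chandra descent at split type-`(2,1)` points).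

THE MATHEMATICS.  Let `P = L N ⊂ G = GL(m ⊕ n, F)` be the block-upper maximal parabolic: `L = {l = diag(A, B)}`, `N = {u(X) = [[1, X],[0, 1]] : X ∈ M_{m×n}(F)}`,
`𝔫 = {ι(X) = [[0, X],[0, 0]]}`.  The unipotent radical is ABELIAN (`u(X) u(Y) = u(X + Y)`, `ι(X) ι(Y) = 0`), so conjugating a Levi element by `u(X)` is AFFINE in `X`:

* (Lie form, §1)   `u(X) · l · u(X)⁻¹ = l + ι(X B − A X)`   for every `l = diag(A, B) ∈ 𝔩 = M_m(F) × M_n(F)`;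
* (group form, §1) `u(X) · l · u(X)⁻¹ = l · u(A⁻¹ X B − X)` for `A` invertible.

Hence, for an additive Haar measure `μ` on `M_{m×n}(F)` and the SYLVESTER OPERATOR `T_l : X ↦ X B − A X` (resp. `T′_l : X ↦ A⁻¹ X B − X`), whenever `T_l` (resp. `T′_l`) is a
linear automorphism of `M_{m×n}(F)` (classically: `A` and `B` have no common eigenvalue, i.e. `l` is `(G, L)`-regular),

* (§3) `∫ f(u(X) l u(X)⁻¹) dμ(X) = mod_F(det T_l)⁻¹ · ∫ f(l + ι X) dμ(X)`   (`N`-orbit of `l` = the affine space `l + 𝔫`, [HarishChandra1999AdmissibleDistributions, Lemma 7.3-type]);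
* (§3) `∫ f(u(X) l u(X)⁻¹) dμ(X) = mod_F(det T′_l)⁻¹ · ∫ f(l · u(X)) dμ(X)` (`N`-orbit of `l` = the coset `l N`, [vanDijk1972]-type ∕ [HarishChandra1970, Lemma 22]),

both as Bochner integrals (any complete normed `ℝ`-space of values, no integrability hypothesis — the two sides are simultaneously meaningful) and as lower
Lebesgue integrals, where `mod_F = distribHaarChar F` is Weil's module (`= ‖·‖_F` for `F` non-archimedean, ★ `UnitaryGroup.distribHaarChar_eq_normAbs`).  The Sylvester
operator enters only through a CHARACTERISING HYPOTHESIS `hT : ∀ X, T X = X * B - A * X` on an abstract `T : M_{m×n}(F) ≃L[F] M_{m×n}(F)` (no definition is introduced;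
the consumer supplies the equivalence, e.g. from `LinearEquiv.ofIsUnitDet`).  The Jacobian is ★ `Literature.MeasureTheory.Group.map_continuousLinearEquiv_addHaar_of_trivialization`
along the coordinate trivialisation `M_{m×n}(F) ≃L[F] (m × n → F)` (§2, from `Matrix.stdBasis`).
NOT here: the value `det T_l = Res(χ_A, χ_B)` (resultant) and the identity `mod_F(det T_l)² = |D_G(l)| ∕ |D_L(l)|` (van Dijk's weight) — brick K3; non-maximal parabolics
(the Borel of `GL₃` is reached in stages `B ⊂ P_{2,1}`, both steps maximal); the reindexing `m ⊕ n ≃ Fin (a + b)` (consumer's `Matrix.reindex`).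

References: [HarishChandra1970] Harish-Chandra (notes by G. van Dijk), *Harmonic analysis on reductive p-adic groups*, LNM 162 (1970), Part III §2 (Lemma 22: the map
`n ↦ n⁻¹ m n m⁻¹` of `N` and its Jacobian `|det(Ad(m⁻¹) − 1)_𝔫|`) · [vanDijk1972] G. van Dijk, *Computation of certain induced characters of p-adic groups*, Math. Ann. 199
(1972), §§3–5 · [HarishChandra1999AdmissibleDistributions] Harish-Chandra (DeBacker–Sally), *Admissible invariant distributions on reductive p-adic groups*, ULECT 16
(1999), §7 (parabolic descent on the Lie algebra) · [WeilBNT1967] A. Weil, *Basic Number Theory*, Ch. I §2 (module of an automorphism).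
HONEST LABEL: HC_CM is proved only modulo the 7 printed citations (2 remaining named inputs: hLiu418 = stmt-HodgeConjecture-24832, h413 = stmt-HodgeConjecture-24833)
until rung 0 closes; count-neutral helper.
-/

set_option autoImplicit false
set_option linter.dupNamespace false   -- `Summit.HodgeConjecture.HodgeConjecture.…` (D-0017 nested layout; lakefile exemption for Summits)

noncomputable section

open MeasureTheory MeasureTheory.Measure Matrix
open scoped ENNReal NNReal

namespace Summit.HodgeConjecture.HodgeConjecture.Cruxes.H413.K2E3GLnMaximalParabolicDescent

/-! ## §1  Algebra of the abelian unipotent radical `u(X) = fromBlocks 1 X 0 1` (any commutative ring) -/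

section Algebra

variable {R : Type*} [CommRing R] {m n : Type*} [Fintype m] [Fintype n] [DecidableEq m] [DecidableEq n]

/-- `u(X) · u(Y) = u(X + Y)`: the unipotent radical of a maximal parabolic of `GL(m ⊕ n)` is abelian, isomorphic to `(M_{m×n}, +)`.
[cite: HarishChandra1970, Part III §2] -/
theorem unipotent_mul_unipotent (X Y : Matrix m n R) :
    fromBlocks (1 : Matrix m m R) X 0 (1 : Matrix n n R) * fromBlocks 1 Y 0 1 = fromBlocks 1 (X + Y) 0 1 := by
  rw [fromBlocks_multiply]
  simp [add_comm]

omit [Fintype m] [Fintype n] in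
/-- `u(0) = 1`. [folklore] -/
theorem unipotent_zero : fromBlocks (1 : Matrix m m R) (0 : Matrix m n R) 0 (1 : Matrix n n R) = 1 :=
  fromBlocks_one

/-- `u(X) · u(−X) = 1`. [folklore] -/
theorem unipotent_mul_unipotent_neg (X : Matrix m n R) :
    fromBlocks (1 : Matrix m m R) X 0 (1 : Matrix n n R) * fromBlocks 1 (-X) 0 1 = 1 := by
  rw [unipotent_mul_unipotent, add_neg_cancel, unipotent_zero]

/-- `u(−X) · u(X) = 1`. [folklore] -/
theorem unipotent_neg_mul_unipotent (X : Matrix m n R) :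
    fromBlocks (1 : Matrix m m R) (-X) 0 (1 : Matrix n n R) * fromBlocks 1 X 0 1 = 1 := by
  rw [unipotent_mul_unipotent, neg_add_cancel, unipotent_zero]

/-- `u(X)⁻¹ = u(−X)` (matrix inverse). [folklore] -/
theorem unipotent_inv (X : Matrix m n R) :
    (fromBlocks (1 : Matrix m m R) X 0 (1 : Matrix n n R))⁻¹ = fromBlocks 1 (-X) 0 1 :=
  inv_eq_right_inv (unipotent_mul_unipotent_neg X)

/-- `det u(X) = 1`. [folklore] -/
theorem det_unipotent (X : Matrix m n R) :
    (fromBlocks (1 : Matrix m m R) X 0 (1 : Matrix n n R)).det = 1 := by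
  rw [det_fromBlocks_zero₂₁, det_one, det_one, mul_one]

/-- `ι(X) · ι(Y) = 0`: the Lie algebra `𝔫` of the unipotent radical has trivial multiplication. [folklore] -/
theorem nilBlock_mul_nilBlock (X Y : Matrix m n R) :
    fromBlocks (0 : Matrix m m R) X 0 (0 : Matrix n n R) * fromBlocks 0 Y 0 0 = 0 := by
  rw [fromBlocks_multiply]
  simp

omit [Fintype m] [Fintype n] in
/-- `u(X) = 1 + ι(X)`. [folklore] -/
theorem unipotent_eq_one_add_nilBlock (X : Matrix m n R) :
    fromBlocks (1 : Matrix m m R) X 0 (1 : Matrix n n R) = 1 + fromBlocks 0 X 0 0 := by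
  rw [← fromBlocks_one, fromBlocks_add]
  simp

/-- **MAXIMAL PARABOLIC DESCENT, LIE FORM**: `u(X) · diag(A, B) · u(X)⁻¹ = diag(A, B) + ι(X B − A X)` — conjugating a Levi element by the abelian unipotent
radical moves it along `𝔫` by the Sylvester operator `X ↦ X B − A X` (here `u(X)⁻¹` is written `u(−X)`, cf. `unipotent_inv`).
[cite: HarishChandra1999AdmissibleDistributions, §7] [cite: HarishChandra1970, Part III §2 Lemma 22] -/
theorem unipotent_conj_levi_eq_add (A : Matrix m m R) (B : Matrix n n R) (X : Matrix m n R) :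
    fromBlocks (1 : Matrix m m R) X 0 (1 : Matrix n n R) * fromBlocks A 0 0 B * fromBlocks 1 (-X) 0 1 =
      fromBlocks A 0 0 B + fromBlocks 0 (X * B - A * X) 0 0 := by
  rw [fromBlocks_multiply, fromBlocks_multiply, fromBlocks_add]
  simp [sub_eq_add_neg, add_comm]

/-- The same with a general element of `𝔭 = 𝔩 ⊕ 𝔫`: `u(X) · [[A, C],[0, B]] · u(−X) = [[A, C + (X B − A X)],[0, B]]` (the `𝔫`-component is translated).
[cite: HarishChandra1999AdmissibleDistributions, §7] -/
theorem unipotent_conj_parabolic_eq (A : Matrix m m R) (B : Matrix n n R) (C X : Matrix m n R) :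
    fromBlocks (1 : Matrix m m R) X 0 (1 : Matrix n n R) * fromBlocks A C 0 B * fromBlocks 1 (-X) 0 1 =
      fromBlocks A (C + (X * B - A * X)) 0 B := by
  rw [fromBlocks_multiply, fromBlocks_multiply]
  simp [sub_eq_add_neg]
  abel

/-- **MAXIMAL PARABOLIC DESCENT, GROUP FORM**: for `A` invertible, `u(X) · diag(A, B) · u(X)⁻¹ = diag(A, B) · u(A⁻¹ X B − X)` — the `N`-conjugates of a Levi
element `l` sweep the coset `l N` through the operator `X ↦ A⁻¹ X B − X = (Ad(l⁻¹) − 1)|_𝔫 (X)`.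
[cite: HarishChandra1970, Part III §2 Lemma 22] [cite: vanDijk1972, §3] -/
theorem unipotent_conj_levi_eq_mul (A : Matrix m m R) (B : Matrix n n R) (hA : IsUnit A.det) (X : Matrix m n R) :
    fromBlocks (1 : Matrix m m R) X 0 (1 : Matrix n n R) * fromBlocks A 0 0 B * fromBlocks 1 (-X) 0 1 =
      fromBlocks A 0 0 B * fromBlocks 1 (A⁻¹ * X * B - X) 0 1 := by
  rw [unipotent_conj_levi_eq_add, fromBlocks_multiply, fromBlocks_add]
  have h : A * (A⁻¹ * X * B - X) = X * B - A * X := by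
    rw [Matrix.mul_sub, ← Matrix.mul_assoc, ← Matrix.mul_assoc, mul_nonsing_inv A hA, Matrix.one_mul]
  simp [h]

/-- Group form read from the right: `u(X)⁻¹ · diag(A, B) · u(X) = diag(A, B) · u(X − A⁻¹ X B)`. [cite: HarishChandra1970, Part III §2 Lemma 22] -/
theorem unipotent_inv_conj_levi_eq_mul (A : Matrix m m R) (B : Matrix n n R) (hA : IsUnit A.det) (X : Matrix m n R) :
    fromBlocks (1 : Matrix m m R) (-X) 0 (1 : Matrix n n R) * fromBlocks A 0 0 B * fromBlocks 1 X 0 1 =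
      fromBlocks A 0 0 B * fromBlocks 1 (X - A⁻¹ * X * B) 0 1 := by
  have h := unipotent_conj_levi_eq_mul A B hA (-X)
  rw [neg_neg] at h
  rw [h]
  congr 2
  rw [Matrix.mul_neg, Matrix.neg_mul, sub_neg_eq_add, neg_add_eq_sub]

end Algebra

/-! ## §2  The coordinate trivialisation `M_{m×n}(F) ≃L[F] (m × n → F)` and the instances it transports -/

section Trivialisation

variable {F : Type*} [TopologicalSpace F] {m n : Type*}

/-- **`M_{m×n}(F)` is continuously linearly isomorphic to `F^{m×n}`** (`X ↦ ((i,j) ↦ X i j)`; the matrix topology IS the product topology).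
[cite: WeilBNT1967, Ch. I §2 Cor. 1 of Thm. 3] -/
theorem exists_continuousLinearEquiv_entries [Field F] :
    ∃ e : Matrix m n F ≃L[F] (m × n → F), ∀ X (p : m × n), e X p = X p.1 p.2 := by
  refine ⟨ContinuousLinearEquiv.mk
    { toFun := fun X p => X p.1 p.2
      invFun := fun c => Matrix.of fun i j => c (i, j)
      map_add' := fun X Y => rfl
      map_smul' := fun a X => rfl
      left_inv := fun X => by ext i j; rfl
      right_inv := fun c => by funext p; rfl } ?_ ?_, fun X p => rfl⟩
  · change Continuous fun X : Matrix m n F => fun p : m × n => X p.1 p.2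
    exact continuous_pi fun p => (continuous_apply p.2).comp (continuous_apply p.1)
  · change Continuous fun c : m × n → F => Matrix.of fun i j => c (i, j)
    exact continuous_matrix fun i j => continuous_apply _

/-- `M_{m×n}(F)` is locally compact (finite product). [folklore] -/
theorem locallyCompactSpace_matrix [LocallyCompactSpace F] [Fintype m] [Fintype n] : LocallyCompactSpace (Matrix m n F) :=
  inferInstanceAs (LocallyCompactSpace (m → n → F))

/-- `M_{m×n}(F)` is second countable (finite product). [folklore] -/
theorem secondCountableTopology_matrix [SecondCountableTopology F] [Fintype m] [Fintype n] :
    SecondCountableTopology (Matrix m n F) :=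
  inferInstanceAs (SecondCountableTopology (m → n → F))

/-- Every additive Haar measure on `M_{m×n}(F)` (`F` locally compact, second countable) is regular. [folklore] -/
theorem regular_of_isAddHaarMeasure [Field F] [IsTopologicalRing F] [LocallyCompactSpace F] [SecondCountableTopology F]
    [Fintype m] [Fintype n] [MeasurableSpace (Matrix m n F)] [BorelSpace (Matrix m n F)]
    (μ : Measure (Matrix m n F)) [μ.IsAddHaarMeasure] : μ.Regular := by
  haveI := locallyCompactSpace_matrix (F := F) (m := m) (n := n)
  haveI := secondCountableTopology_matrix (F := F) (m := m) (n := n)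
  obtain ⟨K, hK, h0K⟩ := exists_compact_mem_nhds (0 : Matrix m n F)
  exact regular_of_isAddLeftInvariant hK ⟨0, mem_interior_iff_mem_nhds.2 h0K⟩ hK.measure_lt_top.ne

end Trivialisation

/-! ## §3  The change of variables: `∫ f(u(X) l u(X)⁻¹) dμ(X) = mod_F(det T_l)⁻¹ ∫ f(l + ι X) dμ(X)` and its group form -/

section Descent

variable {F : Type*} [Field F] [TopologicalSpace F] [IsTopologicalRing F] [LocallyCompactSpace F]
  [SecondCountableTopology F] [MeasurableSpace F] [BorelSpace F]
  {m n : Type*} [Fintype m] [Fintype n] [DecidableEq m] [DecidableEq n]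
  [MeasurableSpace (Matrix m n F)] [BorelSpace (Matrix m n F)]

/-- **`T_* μ = mod_F(det T)⁻¹ · μ` on `M_{m×n}(F)`** for a continuous linear automorphism `T` and an additive Haar measure `μ` (★ linear Jacobian along the entry
trivialisation). [cite: WeilBNT1967, Ch. I §2] -/
theorem map_continuousLinearEquiv_addHaar_matrix (μ : Measure (Matrix m n F)) [μ.IsAddHaarMeasure]
    (T : Matrix m n F ≃L[F] Matrix m n F) :
    μ.map T = (distribHaarChar F (LinearEquiv.det T.toLinearEquiv))⁻¹ • μ := by
  haveI := locallyCompactSpace_matrix (F := F) (m := m) (n := n)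
  haveI := regular_of_isAddHaarMeasure (F := F) μ
  obtain ⟨e, -⟩ := exists_continuousLinearEquiv_entries (F := F) (m := m) (n := n)
  exact Literature.MeasureTheory.Group.map_continuousLinearEquiv_addHaar_of_trivialization μ e T

/-- **Linear change of variables in Bochner integrals over `M_{m×n}(F)`**: `∫ g(T X) dμ(X) = mod_F(det T)⁻¹ • ∫ g dμ` (no integrability hypothesis: both sides vanish
together when `g` is not integrable). [cite: WeilBNT1967, Ch. I §2] -/
theorem integral_comp_continuousLinearEquiv_matrix {E : Type*} [NormedAddCommGroup E] [NormedSpace ℝ E]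
    (μ : Measure (Matrix m n F)) [μ.IsAddHaarMeasure] (T : Matrix m n F ≃L[F] Matrix m n F) (g : Matrix m n F → E) :
    ∫ X, g (T X) ∂μ = ((distribHaarChar F (LinearEquiv.det T.toLinearEquiv))⁻¹ : ℝ≥0) • ∫ X, g X ∂μ := by
  have hT : MeasurableEmbedding (T : Matrix m n F → Matrix m n F) := T.toHomeomorph.measurableEmbedding
  rw [← hT.integral_map, map_continuousLinearEquiv_addHaar_matrix μ T, integral_smul_nnreal_measure]

/-- **Linear change of variables in lower Lebesgue integrals over `M_{m×n}(F)`**: `∫⁻ g(T X) dμ(X) = mod_F(det T)⁻¹ · ∫⁻ g dμ`. [cite: WeilBNT1967, Ch. I §2] -/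
theorem lintegral_comp_continuousLinearEquiv_matrix
    (μ : Measure (Matrix m n F)) [μ.IsAddHaarMeasure] (T : Matrix m n F ≃L[F] Matrix m n F) (g : Matrix m n F → ℝ≥0∞) :
    ∫⁻ X, g (T X) ∂μ = (distribHaarChar F (LinearEquiv.det T.toLinearEquiv))⁻¹ * ∫⁻ X, g X ∂μ := by
  have hT : MeasurableEmbedding (T : Matrix m n F → Matrix m n F) := T.toHomeomorph.measurableEmbedding
  rw [← hT.lintegral_map, map_continuousLinearEquiv_addHaar_matrix μ T, lintegral_smul_measure, ENNReal.smul_def, smul_eq_mul,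
    ENNReal.coe_inv (distribHaarChar_pos).ne']

/-- **MAXIMAL PARABOLIC DESCENT ON THE LIE ALGEBRA (Bochner form).**  Let `l = diag(A, B) ∈ M_m(F) × M_n(F)`, `μ` an additive Haar measure on `M_{m×n}(F)` and
`T` a continuous linear automorphism of `M_{m×n}(F)` which IS the Sylvester operator of `l`, `T X = X B − A X` (so `l` is `(G,L)`-regular).  Then for every
`f : M_{m⊕n}(F) → E`,
`∫ f(u(X) · l · u(X)⁻¹) dμ(X) = mod_F(det T)⁻¹ • ∫ f(l + ι X) dμ(X)`, `u(X) = [[1,X],[0,1]]`, `ι(X) = [[0,X],[0,0]]`: the `N`-orbit of `l` is the affine space `l + 𝔫`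
swept with Jacobian `mod_F(det T_l)`. [cite: HarishChandra1999AdmissibleDistributions, §7] [cite: HarishChandra1970, Part III §2 Lemma 22] [cite: WeilBNT1967, Ch. I §2] -/
theorem integral_comp_unipotent_conj_levi_eq {E : Type*} [NormedAddCommGroup E] [NormedSpace ℝ E]
    (μ : Measure (Matrix m n F)) [μ.IsAddHaarMeasure] (A : Matrix m m F) (B : Matrix n n F)
    (T : Matrix m n F ≃L[F] Matrix m n F) (hT : ∀ X, T X = X * B - A * X) (f : Matrix (m ⊕ n) (m ⊕ n) F → E) :
    ∫ X, f (fromBlocks 1 X 0 1 * fromBlocks A 0 0 B * fromBlocks 1 (-X) 0 1) ∂μ =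
      ((distribHaarChar F (LinearEquiv.det T.toLinearEquiv))⁻¹ : ℝ≥0) • ∫ X, f (fromBlocks A 0 0 B + fromBlocks 0 X 0 0) ∂μ := by
  have h : (fun X => f (fromBlocks 1 X 0 1 * fromBlocks A 0 0 B * fromBlocks 1 (-X) 0 1)) =
      fun X => (fun Y => f (fromBlocks A 0 0 B + fromBlocks 0 Y 0 0)) (T X) := by
    funext X
    simp only [unipotent_conj_levi_eq_add, hT]
  rw [h]
  exact integral_comp_continuousLinearEquiv_matrix μ T (fun Y => f (fromBlocks A 0 0 B + fromBlocks 0 Y 0 0))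

/-- **MAXIMAL PARABOLIC DESCENT ON THE LIE ALGEBRA (lower Lebesgue form)**, same setting with `f ≥ 0` `ℝ≥0∞`-valued.
[cite: HarishChandra1999AdmissibleDistributions, §7] [cite: WeilBNT1967, Ch. I §2] -/
theorem lintegral_comp_unipotent_conj_levi_eq
    (μ : Measure (Matrix m n F)) [μ.IsAddHaarMeasure] (A : Matrix m m F) (B : Matrix n n F)
    (T : Matrix m n F ≃L[F] Matrix m n F) (hT : ∀ X, T X = X * B - A * X) (f : Matrix (m ⊕ n) (m ⊕ n) F → ℝ≥0∞) :
    ∫⁻ X, f (fromBlocks 1 X 0 1 * fromBlocks A 0 0 B * fromBlocks 1 (-X) 0 1) ∂μ =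
      (distribHaarChar F (LinearEquiv.det T.toLinearEquiv))⁻¹ * ∫⁻ X, f (fromBlocks A 0 0 B + fromBlocks 0 X 0 0) ∂μ := by
  have h : (fun X => f (fromBlocks 1 X 0 1 * fromBlocks A 0 0 B * fromBlocks 1 (-X) 0 1)) =
      fun X => (fun Y => f (fromBlocks A 0 0 B + fromBlocks 0 Y 0 0)) (T X) := by
    funext X
    simp only [unipotent_conj_levi_eq_add, hT]
  rw [h]
  exact lintegral_comp_continuousLinearEquiv_matrix μ T (fun Y => f (fromBlocks A 0 0 B + fromBlocks 0 Y 0 0))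

/-- **MAXIMAL PARABOLIC DESCENT ON THE GROUP (Bochner form).**  Let `l = diag(A, B)` with `A` invertible, `μ` an additive Haar measure on `M_{m×n}(F)` and `T′` a
continuous linear automorphism of `M_{m×n}(F)` which IS `X ↦ A⁻¹ X B − X = (Ad(l⁻¹) − 1)|_𝔫`.  Then for every `f`,
`∫ f(u(X) · l · u(X)⁻¹) dμ(X) = mod_F(det T′)⁻¹ • ∫ f(l · u(X)) dμ(X)`: the `N`-conjugates of `l` sweep the coset `l N` with Jacobian `|det(Ad(l⁻¹) − 1)_𝔫|`
(van Dijk's first step towards `χ_{i_P σ}`). [cite: HarishChandra1970, Part III §2 Lemma 22] [cite: vanDijk1972, §3] [cite: WeilBNT1967, Ch. I §2] -/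
theorem integral_comp_unipotent_conj_levi_eq_mul {E : Type*} [NormedAddCommGroup E] [NormedSpace ℝ E]
    (μ : Measure (Matrix m n F)) [μ.IsAddHaarMeasure] (A : Matrix m m F) (B : Matrix n n F) (hA : IsUnit A.det)
    (T' : Matrix m n F ≃L[F] Matrix m n F) (hT' : ∀ X, T' X = A⁻¹ * X * B - X) (f : Matrix (m ⊕ n) (m ⊕ n) F → E) :
    ∫ X, f (fromBlocks 1 X 0 1 * fromBlocks A 0 0 B * fromBlocks 1 (-X) 0 1) ∂μ =
      ((distribHaarChar F (LinearEquiv.det T'.toLinearEquiv))⁻¹ : ℝ≥0) • ∫ X, f (fromBlocks A 0 0 B * fromBlocks 1 X 0 1) ∂μ := by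
  have h : (fun X => f (fromBlocks 1 X 0 1 * fromBlocks A 0 0 B * fromBlocks 1 (-X) 0 1)) =
      fun X => (fun Y => f (fromBlocks A 0 0 B * fromBlocks 1 Y 0 1)) (T' X) := by
    funext X
    simp only [unipotent_conj_levi_eq_mul A B hA, hT']
  rw [h]
  exact integral_comp_continuousLinearEquiv_matrix μ T' (fun Y => f (fromBlocks A 0 0 B * fromBlocks 1 Y 0 1))

/-- **MAXIMAL PARABOLIC DESCENT ON THE GROUP (lower Lebesgue form)**, same setting with `f ≥ 0` `ℝ≥0∞`-valued.
[cite: HarishChandra1970, Part III §2 Lemma 22] [cite: WeilBNT1967, Ch. I §2] -/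
theorem lintegral_comp_unipotent_conj_levi_eq_mul
    (μ : Measure (Matrix m n F)) [μ.IsAddHaarMeasure] (A : Matrix m m F) (B : Matrix n n F) (hA : IsUnit A.det)
    (T' : Matrix m n F ≃L[F] Matrix m n F) (hT' : ∀ X, T' X = A⁻¹ * X * B - X) (f : Matrix (m ⊕ n) (m ⊕ n) F → ℝ≥0∞) :
    ∫⁻ X, f (fromBlocks 1 X 0 1 * fromBlocks A 0 0 B * fromBlocks 1 (-X) 0 1) ∂μ =
      (distribHaarChar F (LinearEquiv.det T'.toLinearEquiv))⁻¹ * ∫⁻ X, f (fromBlocks A 0 0 B * fromBlocks 1 X 0 1) ∂μ := by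
  have h : (fun X => f (fromBlocks 1 X 0 1 * fromBlocks A 0 0 B * fromBlocks 1 (-X) 0 1)) =
      fun X => (fun Y => f (fromBlocks A 0 0 B * fromBlocks 1 Y 0 1)) (T' X) := by
    funext X
    simp only [unipotent_conj_levi_eq_mul A B hA, hT']
  rw [h]
  exact lintegral_comp_continuousLinearEquiv_matrix μ T' (fun Y => f (fromBlocks A 0 0 B * fromBlocks 1 Y 0 1))

/-- **The inverse sweep (group form, Bochner)**: `∫ f(u(X)⁻¹ · l · u(X)) dμ(X) = mod_F(det T″)⁻¹ • ∫ f(l · u(X)) dμ(X)` for `T″ X = X − A⁻¹ X B = (1 − Ad(l⁻¹))|_𝔫`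
— the orientation `n ↦ n⁻¹ l n` used in [HarishChandra1970] Lemma 22. [cite: HarishChandra1970, Part III §2 Lemma 22] [cite: WeilBNT1967, Ch. I §2] -/
theorem integral_comp_unipotent_inv_conj_levi_eq_mul {E : Type*} [NormedAddCommGroup E] [NormedSpace ℝ E]
    (μ : Measure (Matrix m n F)) [μ.IsAddHaarMeasure] (A : Matrix m m F) (B : Matrix n n F) (hA : IsUnit A.det)
    (T'' : Matrix m n F ≃L[F] Matrix m n F) (hT'' : ∀ X, T'' X = X - A⁻¹ * X * B) (f : Matrix (m ⊕ n) (m ⊕ n) F → E) :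
    ∫ X, f (fromBlocks 1 (-X) 0 1 * fromBlocks A 0 0 B * fromBlocks 1 X 0 1) ∂μ =
      ((distribHaarChar F (LinearEquiv.det T''.toLinearEquiv))⁻¹ : ℝ≥0) • ∫ X, f (fromBlocks A 0 0 B * fromBlocks 1 X 0 1) ∂μ := by
  have h : (fun X => f (fromBlocks 1 (-X) 0 1 * fromBlocks A 0 0 B * fromBlocks 1 X 0 1)) =
      fun X => (fun Y => f (fromBlocks A 0 0 B * fromBlocks 1 Y 0 1)) (T'' X) := by
    funext X
    simp only [unipotent_inv_conj_levi_eq_mul A B hA, hT'']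
  rw [h]
  exact integral_comp_continuousLinearEquiv_matrix μ T'' (fun Y => f (fromBlocks A 0 0 B * fromBlocks 1 Y 0 1))

end Descent

end Summit.HodgeConjecture.HodgeConjecture.Cruxes.H413.K2E3GLnMaximalParabolicDescent

end
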